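import Literature.AnabelianGeometry.Anabelioids.AutOfEquivalence
import Literature.AnabelianGeometry.Anabelioids.FiberFunctorUnique
import Literature.AnabelianGeometry.Anabelioids.ExactFunctorProofs
import Literature.AnabelianGeometry.EtaleTheta.CyclotomicEnvelope
import HarnessLib

/-!
# The outer automorphism of `π₁` induced by an automorphism of a connected anabelioid

Mochizuki, *The geometry of anabelioids* [GeoAn], Publ. RIMS **40** (2004), §1.1, Def. 1.1.2 (ii)
p. 10 ("an isomorphism `φ : X ⥲ Y` induces an isomorphism `π₁(X, β) ⥲ π₁(Y, φ(β))`", the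
fundamental group being "independent, up to inner automorphism, of the choice of basepoint")
[cite: MochizukiGeoAn2004, Def. 1.1.2(ii) p.10]; used in *Semi-graphs of anabelioids* [SemiAnbd]
Def. 5.1 (i)(c) p. 62 ("the resulting outer homomorphism `H → Out(π̂₁(𝔾_v))`": an automorphism of the
vertex anabelioid `𝔾_v` acts on `π̂₁(𝔾_v)` by a well-defined OUTER automorphism).

For a Galois category `X` (connected anabelioid), a basepoint (fibre functor) `F`, and a
self-equivalence `P : X ⥤ X` (the pull-back functor of an automorphism of `X`):

* `autOfPath F P e` — the bi-continuous automorphism of `π₁(X, F) = Aut F` determined by `P` and a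
  "path" `e : P ⋙ F ≅ F` (the tree's `pi1Map P F : Aut F → Aut (P ⋙ F)` followed by conjugation by
  `e`); as an element `contAutOfPath F P e` of the tree's `contMulAut (Aut F)`;
* `topOut_mk_contAutOfPath_eq` — changing the path changes the automorphism by an INNER one, so
* `outOfEquivalence F P : TopOut (Aut F)` — the outer automorphism of `π₁(X, F)` induced by `P` — is
  well defined (`outOfEquivalence_eq_mk`), with `outOfEquivalence_id` and the composition law
  `outOfEquivalence_comp` (`P ⋙ Q ↦ out(P) · out(Q)`).

Together with `Literature/Topology/Algebra/ProfiniteOutCongruence.lean` (`Out` of a topologically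
finitely generated profinite group is profinite, `CongrOut.equivTopOut`) this is the classical content
of the abc-iut cell's L3 residual (R2) (`SemiAnbdVocab.ofReal`: `OutVert`, `outRep`).  No new notion:
`pi1Map`, `contMulAut`, `TopOut` are the tree's.  Mathlib-level; nothing disputed is involved.
-/

namespace Literature.AnabelianGeometry.Anabelioids

open CategoryTheory CategoryTheory.Functor CategoryTheory.PreGaloisCategory
open Literature.AnabelianGeometry.EtaleTheta (contMulAut mem_contMulAut innerAut innerContAut TopOut
  innerAut_le_contMulAut)

universe u₁ u₂

/-! ## Conjugation by an isomorphism of basepoints, as an isomorphism of topological groups -/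

section Conj

variable {D : Type u₁} [Category.{u₂} D]

/-- Conjugation by an isomorphism `e : F ≅ G` of functors to finite sets is continuous on
automorphism groups (Mathlib's profinite topologies on `Aut F`): it acts coordinatewise on
`∏_A Aut (F A)` ([GeoAn] §1.1 p. 10: change of basepoint "as topological groups"; the tree's copy in
`FiberFunctorUnique.lean` is private). [cite: MochizukiGeoAn2004, Def. 1.1.2(ii) p.10] -/
theorem continuous_conjAut_iso {F G : D ⥤ FintypeCat.{u₂}} (e : F ≅ G) : Continuous e.conjAut := by
  rw [(autEmbedding_isClosedEmbedding G).isInducing.continuous_iff, continuous_pi_iff]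
  intro A
  have hco : (fun σ : Aut F => autEmbedding G (e.conjAut σ) A) =
      fun σ => (e.app A).conjAut (autEmbedding F σ A) := by
    funext σ
    refine Iso.ext ?_
    simp [Iso.conj_apply, autEmbedding_apply]
  change Continuous fun σ : Aut F => autEmbedding G (e.conjAut σ) A
  rw [hco]
  exact continuous_of_discreteTopology.comp
    ((continuous_apply A).comp (autEmbedding_isClosedEmbedding F).continuous)

/-- `e.symm.conjAut` inverts `e.conjAut` (change of basepoint back and forth).
[cite: MochizukiGeoAn2004, Def. 1.1.2(ii) p.10] -/
theorem conjAut_symm_apply_conjAut {F G : D ⥤ FintypeCat.{u₂}} (e : F ≅ G) (σ : Aut F) :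
    e.symm.conjAut (e.conjAut σ) = σ := by
  rw [← Iso.trans_conjAut, Iso.self_symm_id, Iso.conjAut_apply]
  simp

/-- Conjugation by an isomorphism of basepoints `e : F ≅ G` as an isomorphism of TOPOLOGICAL groups
`Aut F ≃ₜ* Aut G` ("`π₁(X, β)` is independent of `β` up to [a chosen] isomorphism", [GeoAn] §1.1
p. 10). [cite: MochizukiGeoAn2004, Def. 1.1.2(ii) p.10] -/
noncomputable def conjAutContinuous {F G : D ⥤ FintypeCat.{u₂}} (e : F ≅ G) : Aut F ≃ₜ* Aut G :=
  { e.conjAut with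
    continuous_toFun := continuous_conjAut_iso e
    continuous_invFun := by
      have h : ∀ τ, e.conjAut.symm τ = e.symm.conjAut τ := fun τ => by
        have h1 := conjAut_symm_apply_conjAut e.symm τ
        rw [Iso.symm_symm_eq] at h1
        exact (MulEquiv.symm_apply_eq _).mpr h1.symm
      change Continuous fun τ => e.conjAut.symm τ
      simp_rw [h]
      exact continuous_conjAut_iso e.symm }

/-- `conjAutContinuous e` is `e.conjAut` as a function. [cite: MochizukiGeoAn2004, Def. 1.1.2(ii) p.10] -/
@[simp] theorem conjAutContinuous_apply {F G : D ⥤ FintypeCat.{u₂}} (e : F ≅ G) (σ : Aut F) :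
    conjAutContinuous e σ = e.conjAut σ := rfl

end Conj

/-! ## The automorphism of `π₁(X, F)` attached to a self-equivalence and a path -/

variable {X : Type u₁} [Category.{u₂} X] [GaloisCategory X] (F : X ⥤ FintypeCat.{u₂}) [FiberFunctor F]
  (P : X ⥤ X) [P.IsEquivalence]

/-- `π₁(P) : Aut F ≃ₜ* Aut (P ⋙ F)` for an equivalence `P` (a choice of the isomorphism of the tree's
`exists_continuousMulEquiv_aut_of_isEquivalence`; it IS `pi1Map P F`, `pi1Equiv_apply`).
[cite: MochizukiGeoAn2004, Def. 1.1.2(ii) p.10] -/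
noncomputable def pi1Equiv : Aut F ≃ₜ* Aut (P ⋙ F) :=
  Classical.choose (exists_continuousMulEquiv_aut_of_isEquivalence P F)

/-- `pi1Equiv F P σ = pi1Map P F σ`. [cite: MochizukiGeoAn2004, Def. 1.1.2(ii) p.10] -/
@[simp] theorem pi1Equiv_apply (σ : Aut F) : pi1Equiv F P σ = pi1Map P F σ :=
  Classical.choose_spec (exists_continuousMulEquiv_aut_of_isEquivalence P F) σ

/-- **The automorphism of `π₁(X, F)` determined by a self-equivalence `P` and a path
`e : P ⋙ F ≅ F`**: `σ ↦ e⁻¹ ∘ P^*(σ) ∘ e`, an isomorphism of topological groups `Aut F ≃ₜ* Aut F`.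
[cite: MochizukiGeoAn2004, Def. 1.1.2(ii) p.10] -/
noncomputable def autOfPath (e : P ⋙ F ≅ F) : Aut F ≃ₜ* Aut F :=
  (pi1Equiv F P).trans (conjAutContinuous e)

/-- Formula: `autOfPath F P e σ = e.conjAut (pi1Map P F σ)`. [cite: MochizukiGeoAn2004, Def. 1.1.2(ii) p.10] -/
@[simp] theorem autOfPath_apply (e : P ⋙ F ≅ F) (σ : Aut F) :
    autOfPath F P e σ = e.conjAut (pi1Map P F σ) := by
  change conjAutContinuous e (pi1Equiv F P σ) = _
  rw [conjAutContinuous_apply, pi1Equiv_apply]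

/-- The same automorphism as an element of `Aut_top(π₁(X, F)) = contMulAut (Aut F)`.
[cite: MochizukiGeoAn2004, Def. 1.1.2(ii) p.10] -/
noncomputable def contAutOfPath (e : P ⋙ F ≅ F) : contMulAut (Aut F) :=
  ⟨(autOfPath F P e).toMulEquiv,
    (mem_contMulAut (Aut F)).mpr ⟨(autOfPath F P e).continuous, (autOfPath F P e).symm.continuous⟩⟩

/-- Underlying function of `contAutOfPath`. [cite: MochizukiGeoAn2004, Def. 1.1.2(ii) p.10] -/
@[simp] theorem contAutOfPath_apply (e : P ⋙ F ≅ F) (σ : Aut F) :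
    ((contAutOfPath F P e : contMulAut (Aut F)) : MulAut (Aut F)) σ = e.conjAut (pi1Map P F σ) :=
  autOfPath_apply F P e σ

omit [GaloisCategory X] [FiberFunctor F] in
/-- Conjugation by `τ ∈ Aut F` (as an isomorphism `F ≅ F`) is the inner automorphism `Inn(τ)` of the
group `Aut F` ("independent, up to inner automorphism, of the choice of basepoint", [GeoAn] §1.1 p. 10).
[cite: MochizukiGeoAn2004, Def. 1.1.2(ii) p.10] -/
theorem conjAut_eq_conj (τ σ : Aut F) : Iso.conjAut (X := F) (Y := F) τ σ = MulAut.conj τ σ := by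
  rw [Iso.conjAut_apply, MulAut.conj_apply, Aut.Aut_mul_def, Aut.Aut_mul_def, Aut.Aut_inv_def]

/-- **Changing the path changes the automorphism by an inner automorphism**: for two paths
`e, e' : P ⋙ F ≅ F`, `autOfPath e' = Inn(e⁻¹e') ∘ autOfPath e`.
[cite: MochizukiGeoAn2004, Def. 1.1.2(ii) p.10] -/
theorem contAutOfPath_eq_conj_mul (e e' : P ⋙ F ≅ F) :
    (contAutOfPath F P e' : MulAut (Aut F)) =
      @MulAut.conj (Aut F) _ (e.symm ≪≫ e') * (contAutOfPath F P e : MulAut (Aut F)) := by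
  apply MulEquiv.ext
  intro σ
  rw [MulAut.mul_apply, contAutOfPath_apply, contAutOfPath_apply, ← conjAut_eq_conj,
    ← Iso.trans_conjAut, Iso.self_symm_id_assoc]

/-- Hence the two automorphisms have the same class in `Out(π₁(X, F)) = TopOut (Aut F)`.
[cite: MochizukiGeoAn2004, Def. 1.1.2(ii) p.10] -/
theorem topOut_mk_contAutOfPath_eq (e e' : P ⋙ F ≅ F) :
    TopOut.mk (Aut F) (contAutOfPath F P e) = TopOut.mk (Aut F) (contAutOfPath F P e') := by
  rw [TopOut.mk, QuotientGroup.mk'_apply, QuotientGroup.mk'_apply, QuotientGroup.eq]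
  -- `(α_e)⁻¹ * α_{e'} = (α_e)⁻¹ * Inn(τ) * α_e ∈ Inn`
  have hτ : (@MulAut.conj (Aut F) _ (e.symm ≪≫ e') : MulAut (Aut F)) ∈ innerAut (Aut F) := ⟨_, rfl⟩
  have hmem : ((contAutOfPath F P e)⁻¹ * contAutOfPath F P e' : contMulAut (Aut F)).1 ∈ innerAut (Aut F) := by
    change ((contAutOfPath F P e : MulAut (Aut F)))⁻¹ * (contAutOfPath F P e' : MulAut (Aut F)) ∈ _
    rw [contAutOfPath_eq_conj_mul F P e e', ← mul_assoc]
    have := (EtaleTheta.innerAut_normal (Aut F)).conj_mem _ hτ ((contAutOfPath F P e : MulAut (Aut F)))⁻¹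
    rwa [inv_inv] at this
  exact hmem

/-! ## The outer automorphism of `π₁(X, F)` induced by a self-equivalence -/

/-- A path exists: `P ⋙ F` is again a fibre functor (exactness of the equivalence `P`, the tree's
`fiberFunctor_comp_of_exact`), and fibre functors are isomorphic ([SGA1] V 5.7, the tree's
`nonempty_iso_of_fiberFunctor`). [cite: MochizukiGeoAn2004, Def. 1.1.2(ii) p.10] -/
theorem nonempty_path : Nonempty (P ⋙ F ≅ F) := by
  haveI : FiberFunctor (P ⋙ F) := fiberFunctor_comp_of_exact P F
  exact nonempty_iso_of_fiberFunctor (P ⋙ F) F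

/-- **The outer automorphism `out(P) ∈ Out(π₁(X, F))` induced by a self-equivalence `P` of a
connected anabelioid** ([SemiAnbd] Def. 5.1 (i)(c): "the resulting outer homomorphism"), independent
of the path. [cite: MochizukiGeoAn2004, Def. 1.1.2(ii) p.10] -/
noncomputable def outOfEquivalence : TopOut (Aut F) :=
  TopOut.mk (Aut F) (contAutOfPath F P (Classical.choice (nonempty_path F P)))

/-- `out(P)` may be computed with ANY path. [cite: MochizukiGeoAn2004, Def. 1.1.2(ii) p.10] -/
theorem outOfEquivalence_eq_mk (e : P ⋙ F ≅ F) :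
    outOfEquivalence F P = TopOut.mk (Aut F) (contAutOfPath F P e) :=
  topOut_mk_contAutOfPath_eq F P _ e

/-! ## Identity and composition -/

/-- The identity equivalence with the unit path acts trivially on `π₁`.
[cite: MochizukiGeoAn2004, Def. 1.1.2(ii) p.10] -/
theorem contAutOfPath_id : contAutOfPath F (𝟭 X) F.leftUnitor = 1 := by
  apply Subtype.ext
  apply MulEquiv.ext
  intro σ
  rw [contAutOfPath_apply]
  change F.leftUnitor.conjAut (pi1Map (𝟭 X) F σ) = σ
  refine Iso.ext (NatTrans.ext (funext fun A => ?_))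
  simp only [Iso.conjAut_hom, Iso.conj_apply, pi1Map_hom_app, Functor.leftUnitor_inv_app,
    Functor.leftUnitor_hom_app, NatTrans.comp_app]
  erw [Category.id_comp, Category.comp_id]
  rfl

/-- `out(𝟭) = 1`. [cite: MochizukiGeoAn2004, Def. 1.1.2(ii) p.10] -/
theorem outOfEquivalence_id : outOfEquivalence F (𝟭 X) = 1 := by
  rw [outOfEquivalence_eq_mk F (𝟭 X) F.leftUnitor, contAutOfPath_id, map_one]

variable (Q : X ⥤ X) [Q.IsEquivalence]

omit [GaloisCategory X] [FiberFunctor F] [P.IsEquivalence] [Q.IsEquivalence] in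
/-- `π₁` of a composite: `pi1Map (P ⋙ Q) F = pi1Map P (Q ⋙ F) ∘ pi1Map Q F` (local copy of the
tree's `pi1Map_comp_apply` of `SemiGraphs/ApproximatorImageProofs.lean`, to keep the imports of this
file inside `Anabelioids/`). [cite: MochizukiGeoAn2004, Def. 1.1.2(ii) p.10] -/
private theorem pi1Map_comp_apply' (σ : Aut F) : pi1Map (P ⋙ Q) F σ = pi1Map P (Q ⋙ F) (pi1Map Q F σ) := by
  refine Iso.ext (NatTrans.ext (funext fun A => ?_))
  simp only [pi1Map_hom_app]
  rfl

/-- With the composite path `(P ◁ e_Q) ≫ e_P`, the automorphism of a composite is the composite of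
the automorphisms: `α_{P ⋙ Q} = α_P ∘ α_Q`. [cite: MochizukiGeoAn2004, Def. 1.1.2(ii) p.10] -/
theorem contAutOfPath_comp (eP : P ⋙ F ≅ F) (eQ : Q ⋙ F ≅ F) :
    contAutOfPath F (P ⋙ Q) (isoWhiskerLeft P eQ ≪≫ eP) = contAutOfPath F P eP * contAutOfPath F Q eQ := by
  apply Subtype.ext
  apply MulEquiv.ext
  intro σ
  change ((contAutOfPath F (P ⋙ Q) (isoWhiskerLeft P eQ ≪≫ eP) : contMulAut (Aut F)) : MulAut (Aut F)) σ =
    ((contAutOfPath F P eP : contMulAut (Aut F)) : MulAut (Aut F))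
      (((contAutOfPath F Q eQ : contMulAut (Aut F)) : MulAut (Aut F)) σ)
  rw [contAutOfPath_apply, contAutOfPath_apply, contAutOfPath_apply, pi1Map_conjAut,
    Iso.trans_conjAut, pi1Map_comp_apply']
  rfl

/-- **`out` is multiplicative**: `out(P ⋙ Q) = out(P) · out(Q)` in `Out(π₁(X, F))` (pull-back
functors compose contravariantly to the morphisms of anabelioids, so on automorphisms `φ ↦ out(φ^*)`
is an anti-homomorphism, i.e. a homomorphism from the opposite group).
[cite: MochizukiGeoAn2004, Def. 1.1.2(ii) p.10] -/
theorem outOfEquivalence_comp :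
    outOfEquivalence F (P ⋙ Q) = outOfEquivalence F P * outOfEquivalence F Q := by
  obtain ⟨eP⟩ := nonempty_path F P
  obtain ⟨eQ⟩ := nonempty_path F Q
  rw [outOfEquivalence_eq_mk F (P ⋙ Q) (isoWhiskerLeft P eQ ≪≫ eP), outOfEquivalence_eq_mk F P eP,
    outOfEquivalence_eq_mk F Q eQ, contAutOfPath_comp, map_mul]

end Literature.AnabelianGeometry.Anabelioids
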